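import Summits.RiemannHypothesis.RiemannHypothesis.Theorems.SuzukiWindowsDoorCoeffPrimePower

/-!
# SuzukiWindowsDoorCoeffMultiplicative — multiplicativity of the Ihara–Matsumoto coefficients `λ_θ` (column DBR; RH-FREE)

RH-FREE throughout; nothing here bears on the truth of RH.  The MULTIPLICATIVITY CLAUSE of the column's typed target
`LimCoeffPrimePowerLaw` (theory's P1f): for coprime `m, n`, `λ_θ(mn) = λ_θ(m) λ_θ(n)`, for the tree's
`limCoeff θ n = Σ_{j ≤ Ω(n)} (2θ)ʲ/j! Λ^{∗j}(n)` ([Su20] (1.10): «endowed with multiplicative coefficients `λ_θ(n)`»).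
Together with `SuzukiWindowsDoorCoeffPrimePower.limCoeff_prime_pow` this is the complete formula by which the engine
lineages tabulate `λ_θ` (multiplicative extension of the prime-power law), and `limCoeffPrimePowerLaw` below is P1f
in exactly the typed shape.

* §1 generic facts on Dirichlet convolution powers: evaluation of finite sums and of `k • F`; LOCALITY (`(F^{∗j})(d)`,
  `d ∣ N`, depends only on `F` on the divisors of `N`); supports coprime to `n` are stable under convolution powers;
  COPRIME-SUPPORT EVALUATION `(F ∗ G)(mn) = F(m) G(n)` when `F` lives on integers coprime to `n` and `G` on integers
  coprime to `m`;
* §2 the BINOMIAL CONVOLUTION IDENTITY `Λ^{∗j}(mn) = Σ_i C(j,i) Λ^{∗i}(m) Λ^{∗(j−i)}(n)` for coprime `m, n`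
  (split `Λ = Λ·[coprime to n] + Λ·[not coprime to n]` and expand `(F + G)^{∗j}` in the Dirichlet ring);
* §3 the exponential generating polynomial `P_N(X) = Σ_j Λ^{∗j}(N)/j! Xʲ` with `λ_θ(N) = P_N(2θ)` and
  `P_{mn} = P_m P_n` ⇒ **`limCoeff_mul_of_coprime`**, and `limCoeffPrimePowerLaw`.

References: [Su20] M. Suzuki, ASPM 84 (2020) 399–411 = arXiv:1907.07302, §1 (1.10).
-/

noncomputable section

-- D-0017: `Summit.<S>.<S>.…` is the designed namespace of a single-problem summit.
set_option linter.dupNamespace false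

open Filter Topology Finset

namespace Summit.RiemannHypothesis.RiemannHypothesis.Theorems.SuzukiWindowsDoorCoeffMultiplicative

open Literature.NumberTheory.LFunctions
open scoped ArithmeticFunction.vonMangoldt ArithmeticFunction.Omega Nat
open ArithmeticFunction (mul_apply one_apply zero_apply cardFactors_mul vonMangoldt_ne_zero_iff)
open SuzukiWindowsDoorDirichletSymbol (vonMangoldt_pow_apply_eq_zero)
open SuzukiWindowsDoorCoeffPrimePower (limCoeff_prime_pow limCoeff_prime_pow_one limCoeff_zero)

/-! ## §1 Generic facts on Dirichlet convolution powers -/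

/-- Evaluation of a finite sum of arithmetic functions (private copy of the tree's
`Literature.NumberTheory.Sieve.HeathBrown.finset_sum_apply`, to keep the sieve files out of this import chain). -/
private theorem finset_sum_apply {ι : Type*} (s : Finset ι) (F : ι → ArithmeticFunction ℝ) (N : ℕ) :
    (∑ i ∈ s, F i) N = ∑ i ∈ s, F i N := by
  induction s using Finset.cons_induction with
  | empty => simp
  | cons a s ha ih => rw [sum_cons, sum_cons, ArithmeticFunction.add_apply, ih]

/-- Evaluation of `k • F`. -/
theorem nsmul_apply (k : ℕ) (F : ArithmeticFunction ℝ) (N : ℕ) : (k • F) N = (k : ℝ) * F N := by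
  induction k with
  | zero => simp
  | succ k ih =>
    rw [succ_nsmul, ArithmeticFunction.add_apply, ih]
    push_cast
    ring

/-- RH-FREE.  LOCALITY: if `F = G` on the divisors of `N`, then `F^{∗j} = G^{∗j}` on the divisors of `N`. -/
theorem pow_apply_eq_of_forall_dvd {F G : ArithmeticFunction ℝ} {N : ℕ} (h : ∀ d : ℕ, d ∣ N → F d = G d)
    (j : ℕ) : ∀ d : ℕ, d ∣ N → (F ^ j) d = (G ^ j) d := by
  induction j with
  | zero => intro d _; rw [pow_zero, pow_zero]
  | succ j ih =>
    intro d hd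
    rw [pow_succ, pow_succ, mul_apply, mul_apply]
    refine sum_congr rfl fun x hx => ?_
    have hx' := (Nat.mem_divisorsAntidiagonal.1 hx).1
    rw [ih x.1 ((Dvd.intro _ hx').trans hd), h x.2 ((Dvd.intro_left _ hx').trans hd)]

/-- RH-FREE.  If `F` lives on integers coprime to `n`, so does every `F^{∗i}`. -/
theorem coprime_of_pow_apply_ne_zero {F : ArithmeticFunction ℝ} {n : ℕ}
    (hF : ∀ d : ℕ, F d ≠ 0 → Nat.Coprime d n) (i : ℕ) : ∀ d : ℕ, (F ^ i) d ≠ 0 → Nat.Coprime d n := by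
  induction i with
  | zero =>
    intro d hd
    rw [pow_zero, one_apply] at hd
    have : d = 1 := by
      by_contra h
      exact hd (if_neg h)
    rw [this]
    exact Nat.coprime_one_left n
  | succ i ih =>
    intro d hd
    rw [pow_succ, mul_apply] at hd
    obtain ⟨x, hx, hne⟩ := Finset.exists_ne_zero_of_sum_ne_zero hd
    have hx' := (Nat.mem_divisorsAntidiagonal.1 hx).1
    rw [← hx']
    exact Nat.Coprime.mul_left (ih x.1 (left_ne_zero_of_mul hne)) (hF x.2 (right_ne_zero_of_mul hne))

/-- RH-FREE.  COPRIME-SUPPORT EVALUATION: if `F` lives on integers coprime to `n` and `G` on integers coprime to `m`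
(`m, n ≥ 1`), then `(F ∗ G)(mn) = F(m) G(n)` — in `Σ_{de = mn} F(d) G(e)` only `(d, e) = (m, n)` survives. -/
theorem mul_apply_mul_of_coprime_support {F G : ArithmeticFunction ℝ} {m n : ℕ} (hm : m ≠ 0) (hn : n ≠ 0)
    (hF : ∀ d : ℕ, F d ≠ 0 → Nat.Coprime d n) (hG : ∀ e : ℕ, G e ≠ 0 → Nat.Coprime e m) :
    (F * G) (m * n) = F m * G n := by
  rw [mul_apply]
  have hmem : (m, n) ∈ (m * n).divisorsAntidiagonal :=
    Nat.mem_divisorsAntidiagonal.2 ⟨rfl, mul_ne_zero hm hn⟩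
  rw [Finset.sum_eq_single_of_mem (m, n) hmem]
  intro x hx hne
  by_contra h
  have h1 : F x.1 ≠ 0 := left_ne_zero_of_mul h
  have h2 : G x.2 ≠ 0 := right_ne_zero_of_mul h
  have hx' := (Nat.mem_divisorsAntidiagonal.1 hx).1
  obtain ⟨a, ha⟩ := (hF x.1 h1).dvd_of_dvd_mul_right (Dvd.intro _ hx')
  obtain ⟨b, hb⟩ := (hG x.2 h2).dvd_of_dvd_mul_left (Dvd.intro_left _ hx')
  have hx0 : x.1 * x.2 ≠ 0 := by rw [hx']; exact mul_ne_zero hm hn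
  have hab : a * b = 1 := by
    have e : x.1 * x.2 * (a * b) = x.1 * x.2 * 1 := by
      calc x.1 * x.2 * (a * b) = (x.1 * a) * (x.2 * b) := by ring
        _ = m * n := by rw [← ha, ← hb]
        _ = x.1 * x.2 * 1 := by rw [← hx', mul_one]
    exact Nat.eq_of_mul_eq_mul_left (Nat.pos_of_ne_zero hx0) e
  have ha1 : a = 1 := Nat.eq_one_of_mul_eq_one_right hab
  have hb1 : b = 1 := Nat.eq_one_of_mul_eq_one_left hab
  rw [ha1, mul_one] at ha
  rw [hb1, mul_one] at hb
  exact hne (Prod.ext ha.symm hb.symm)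

/-! ## §2 The binomial convolution identity for `Λ^{∗j}` at coprime arguments -/

/-- RH-FREE.  A prime power `p^i` (`i ≥ 1`) not coprime to `n` has `p ∣ n`; one dividing `n` is not coprime to `n`;
and if `p ∣ n` with `m, n` coprime then `p^i` is coprime to `m`.  Packaged: for `Λ(e) ≠ 0` and `¬ Coprime e n`,
`Coprime e m`. -/
theorem coprime_of_vonMangoldt_ne_zero_of_not_coprime {m n e : ℕ} (hmn : Nat.Coprime m n) (hΛ : Λ e ≠ 0)
    (hce : ¬ Nat.Coprime e n) : Nat.Coprime e m := by
  obtain ⟨p, i, hp, _, rfl⟩ := (isPrimePow_nat_iff _).1 (vonMangoldt_ne_zero_iff.1 hΛ)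
  have hpn : p ∣ n := by
    by_contra hnd
    exact hce (Nat.Coprime.pow_left i ((Nat.Prime.coprime_iff_not_dvd hp).2 hnd))
  have hpm : ¬ p ∣ m := fun hpm =>
    hp.one_lt.ne' (Nat.dvd_one.1 (hmn ▸ Nat.dvd_gcd hpm hpn))
  exact Nat.Coprime.pow_left i ((Nat.Prime.coprime_iff_not_dvd hp).2 hpm)

/-- RH-FREE.  If `Λ(e) ≠ 0` and `e ∣ n` then `e` is not coprime to `n` (`e = p^i`, `i ≥ 1`, `p ∣ n`). -/
theorem not_coprime_of_vonMangoldt_ne_zero_of_dvd {n e : ℕ} (hΛ : Λ e ≠ 0) (he : e ∣ n) :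
    ¬ Nat.Coprime e n := by
  obtain ⟨p, i, hp, hi, rfl⟩ := (isPrimePow_nat_iff _).1 (vonMangoldt_ne_zero_iff.1 hΛ)
  intro hc
  have hpn : p ∣ n := (dvd_pow_self p hi.ne').trans he
  have hp1 : Nat.Coprime p n := hc.coprime_dvd_left (dvd_pow_self p hi.ne')
  exact hp.one_lt.ne' (Nat.Coprime.eq_one_of_dvd hp1 hpn)

/-- RH-FREE.  **BINOMIAL CONVOLUTION IDENTITY**: for coprime `m, n` and every `j`,
`Λ^{∗j}(mn) = Σ_{i=0}^{j} C(j,i) · Λ^{∗i}(m) · Λ^{∗(j−i)}(n)`. -/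
theorem vonMangoldt_pow_apply_mul_of_coprime {m n : ℕ} (hmn : Nat.Coprime m n) (j : ℕ) :
    (Λ ^ j) (m * n) = ∑ i ∈ range (j + 1), (j.choose i : ℝ) * ((Λ ^ i) m * (Λ ^ (j - i)) n) := by
  rcases Nat.eq_zero_or_pos m with rfl | hm
  · simp
  rcases Nat.eq_zero_or_pos n with rfl | hn
  · simp
  -- split `Λ` along the coprime factorisation
  set F : ArithmeticFunction ℝ := ⟨fun d => if Nat.Coprime d n then Λ d else 0, by simp⟩ with hFdef
  set G : ArithmeticFunction ℝ := ⟨fun d => if Nat.Coprime d n then 0 else Λ d, by simp⟩ with hGdef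
  have hFapply : ∀ d, F d = if Nat.Coprime d n then Λ d else 0 := fun d => rfl
  have hGapply : ∀ d, G d = if Nat.Coprime d n then 0 else Λ d := fun d => rfl
  have hFG : (Λ : ArithmeticFunction ℝ) = F + G := by
    ext d
    rw [ArithmeticFunction.add_apply, hFapply, hGapply]
    split_ifs <;> simp
  have hF : ∀ d, F d ≠ 0 → Nat.Coprime d n := fun d hd => by
    by_contra hc
    exact hd (by rw [hFapply, if_neg hc])
  have hG : ∀ e, G e ≠ 0 → Nat.Coprime e m := fun e he => by
    have hce : ¬ Nat.Coprime e n := fun hc => he (by rw [hGapply, if_pos hc])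
    have hΛ : Λ e ≠ 0 := fun h0 => he (by rw [hGapply, if_neg hce, h0])
    exact coprime_of_vonMangoldt_ne_zero_of_not_coprime hmn hΛ hce
  have hFm : ∀ d, d ∣ m → F d = Λ d := fun d hd => by
    rw [hFapply, if_pos (hmn.coprime_dvd_left hd)]
  have hGn : ∀ e, e ∣ n → G e = Λ e := fun e he => by
    rw [hGapply]
    by_cases hΛ : Λ e = 0
    · simp [hΛ]
    · rw [if_neg (not_coprime_of_vonMangoldt_ne_zero_of_dvd hΛ he)]
  -- binomial theorem in the (commutative) Dirichlet ring, evaluated at `mn`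
  conv_lhs => rw [hFG, add_pow, finset_sum_apply]
  refine sum_congr rfl fun i _ => ?_
  rw [mul_comm _ ((j.choose i : ℕ) : ArithmeticFunction ℝ), ← nsmul_eq_mul, nsmul_apply,
    mul_apply_mul_of_coprime_support hm.ne' hn.ne' (coprime_of_pow_apply_ne_zero hF i)
      (coprime_of_pow_apply_ne_zero hG (j - i)),
    pow_apply_eq_of_forall_dvd hFm i m dvd_rfl, pow_apply_eq_of_forall_dvd hGn (j - i) n dvd_rfl]

/-- RH-FREE.  The same identity in divided (exponential-generating) form:
`Λ^{∗j}(mn)/j! = Σ_{i+l=j} (Λ^{∗i}(m)/i!) (Λ^{∗l}(n)/l!)`. -/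
theorem vonMangoldt_pow_apply_mul_div_factorial {m n : ℕ} (hmn : Nat.Coprime m n) (j : ℕ) :
    (Λ ^ j) (m * n) / (j.factorial : ℝ) =
      ∑ x ∈ antidiagonal j, (Λ ^ x.1) m / (x.1.factorial : ℝ) * ((Λ ^ x.2) n / (x.2.factorial : ℝ)) := by
  rw [vonMangoldt_pow_apply_mul_of_coprime hmn j, sum_div,
    Finset.Nat.sum_antidiagonal_eq_sum_range_succ
      (fun a b => (Λ ^ a) m / (a.factorial : ℝ) * ((Λ ^ b) n / (b.factorial : ℝ))) j]
  refine sum_congr rfl fun i hi => ?_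
  rw [mem_range] at hi
  have hij : i ≤ j := by omega
  have hfac : (j.factorial : ℝ) = (j.choose i : ℝ) * (i.factorial : ℝ) * ((j - i).factorial : ℝ) := by
    exact_mod_cast (Nat.choose_mul_factorial_mul_factorial hij).symm
  rw [hfac]
  have hi0 : (i.factorial : ℝ) ≠ 0 := by positivity
  have hji0 : ((j - i).factorial : ℝ) ≠ 0 := by positivity
  have hc0 : (j.choose i : ℝ) ≠ 0 := by
    exact_mod_cast (Nat.choose_pos hij).ne'
  field_simp

/-! ## §3 The exponential generating polynomial and multiplicativity of `λ_θ` -/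

/-- RH-FREE.  `λ_θ(N)` as a sum over any range beyond `Ω(N)`: `λ_θ(N) = Σ_{j<K} (2θ)ʲ/j! Λ^{∗j}(N)` for `K > Ω(N)`. -/
theorem limCoeff_eq_sum_range (θ : ℝ) {N K : ℕ} (hK : Ω N < K) :
    limCoeff θ N = ∑ j ∈ range K, (2 * θ) ^ j / (j.factorial : ℝ) * (Λ ^ j) N := by
  unfold limCoeff
  refine Finset.sum_subset (range_subset_range.2 (by omega)) fun j _ hj => ?_
  rw [mem_range, not_lt] at hj
  rw [vonMangoldt_pow_apply_eq_zero (by omega), mul_zero]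

/-- RH-FREE.  The coefficients of the exponential generating polynomial `P_{N,K}(X) = Σ_{j<K} Λ^{∗j}(N)/j! · Xʲ`
(`K > Ω(N)`): `coeff_j P = Λ^{∗j}(N)/j!` for EVERY `j`. -/
theorem coeff_genPoly {N K : ℕ} (hK : Ω N < K) (j : ℕ) :
    (∑ i ∈ range K, Polynomial.monomial i ((Λ ^ i) N / (i.factorial : ℝ))).coeff j =
      (Λ ^ j) N / (j.factorial : ℝ) := by
  rw [Polynomial.finsetSum_coeff]
  simp_rw [Polynomial.coeff_monomial]
  rw [Finset.sum_ite_eq' (range K) j]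
  split_ifs with hj
  · rfl
  · rw [mem_range, not_lt] at hj
    rw [vonMangoldt_pow_apply_eq_zero (by omega), zero_div]

/-- RH-FREE.  `λ_θ(N) = P_{N,K}(2θ)` (`K > Ω(N)`). -/
theorem limCoeff_eq_eval_genPoly (θ : ℝ) {N K : ℕ} (hK : Ω N < K) :
    limCoeff θ N = (∑ i ∈ range K, Polynomial.monomial i ((Λ ^ i) N / (i.factorial : ℝ))).eval (2 * θ) := by
  rw [limCoeff_eq_sum_range θ hK, Polynomial.eval_finsetSum]
  refine sum_congr rfl fun i _ => ?_
  rw [Polynomial.eval_monomial]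
  ring

/-- RH-FREE.  **MULTIPLICATIVITY [Su20] (1.10)** (multiplicativity clause of the column's `LimCoeffPrimePowerLaw`):
for coprime `m, n`, `λ_θ(mn) = λ_θ(m) λ_θ(n)` (the generating polynomials multiply: `P_{mn} = P_m P_n`). -/
theorem limCoeff_mul_of_coprime (θ : ℝ) {m n : ℕ} (hmn : Nat.Coprime m n) :
    limCoeff θ (m * n) = limCoeff θ m * limCoeff θ n := by
  rcases Nat.eq_zero_or_pos m with rfl | hm
  · rw [zero_mul, limCoeff_zero, zero_mul]
  rcases Nat.eq_zero_or_pos n with rfl | hn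
  · rw [mul_zero, limCoeff_zero, mul_zero]
  set K : ℕ := Ω m + Ω n + 1 with hKdef
  have hKm : Ω m < K := by omega
  have hKn : Ω n < K := by omega
  have hKmn : Ω (m * n) < K := by rw [cardFactors_mul hm.ne' hn.ne']; omega
  have hmul : (∑ i ∈ range K, Polynomial.monomial i ((Λ ^ i) (m * n) / (i.factorial : ℝ))) =
      (∑ i ∈ range K, Polynomial.monomial i ((Λ ^ i) m / (i.factorial : ℝ))) *
        (∑ i ∈ range K, Polynomial.monomial i ((Λ ^ i) n / (i.factorial : ℝ))) := by
    refine Polynomial.ext fun j => ?_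
    rw [coeff_genPoly hKmn, Polynomial.coeff_mul, vonMangoldt_pow_apply_mul_div_factorial hmn j]
    refine sum_congr rfl fun x _ => ?_
    rw [coeff_genPoly hKm, coeff_genPoly hKn]
  rw [limCoeff_eq_eval_genPoly θ hKmn, limCoeff_eq_eval_genPoly θ hKm, limCoeff_eq_eval_genPoly θ hKn, hmul,
    Polynomial.eval_mul]

/-- RH-FREE.  `λ_θ` is a multiplicative arithmetic function (`λ_θ(1) = 1`, `λ_θ(mn) = λ_θ(m)λ_θ(n)` for coprime `m,n`). -/
theorem isMultiplicative_limCoeff (θ : ℝ) :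
    ArithmeticFunction.IsMultiplicative (⟨fun n => limCoeff θ n, limCoeff_zero θ⟩ : ArithmeticFunction ℝ) :=
  ⟨limCoeff_one θ, fun hmn => limCoeff_mul_of_coprime θ hmn⟩

/-- RH-FREE.  **`LimCoeffPrimePowerLaw θ` PROVED** in exactly the typed shape of the column's target (theory's P1f,
HOME/rh-dbr-theory/lean/SuzukiCanonicalWindow.lean): `λ_θ(1) = 1`, multiplicativity at coprime arguments, and the
prime-power law `λ_θ(p^k) = Σ_{j=1}^{k} C(k−1,j−1) (2θ log p)ʲ/j!`. -/
theorem limCoeffPrimePowerLaw (θ : ℝ) :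
    limCoeff θ 1 = 1 ∧
    (∀ m n : ℕ, Nat.Coprime m n → limCoeff θ (m * n) = limCoeff θ m * limCoeff θ n) ∧
    ∀ p k : ℕ, p.Prime → 1 ≤ k →
      limCoeff θ (p ^ k) =
        ∑ j ∈ Finset.Icc 1 k,
          (Nat.choose (k - 1) (j - 1) : ℝ) * (2 * θ * Real.log (p : ℝ)) ^ j / (j.factorial : ℝ) :=
  ⟨limCoeff_one θ, fun _ _ hmn => limCoeff_mul_of_coprime θ hmn, fun _ _ hp hk => limCoeff_prime_pow θ hp hk⟩

/-- RH-FREE.  Example (the first composite window term, entering at `x = log 6`, i.e. `t > (log 6)/2 ≈ 0.896`):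
`λ_θ(6) = λ_θ(2) λ_θ(3) = 4θ² log 2 log 3`. -/
theorem limCoeff_six (θ : ℝ) : limCoeff θ 6 = 4 * θ ^ 2 * Real.log 2 * Real.log 3 := by
  rw [show (6 : ℕ) = 2 ^ 1 * 3 ^ 1 by norm_num, limCoeff_mul_of_coprime θ (by norm_num),
    limCoeff_prime_pow_one θ Nat.prime_two, limCoeff_prime_pow_one θ Nat.prime_three]
  push_cast
  ring

end Summit.RiemannHypothesis.RiemannHypothesis.Theorems.SuzukiWindowsDoorCoeffMultiplicative

end
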